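import Summits.QuantumFields.YangMills.Theorems.AllWindowsColdBoxBoxHighLineTiltUEvenL2
import Summits.QuantumFields.YangMills.Theorems.AllWindowsColdBoxBoxHighLineTiltTruncation
import Summits.QuantumFields.YangMills.Theorems.AllWindowsColdBoxBoxHighLineTiltSupBounds
import Summits.QuantumFields.YangMills.Theorems.AllWindowsColdBoxBoxHighLineCubicByName
import Summits.QuantumFields.YangMills.Theorems.AllWindowsColdBoxBoxHighLineTiltCum3Split

/-!
# T-S5.13K-U, PARITY SIZES — the restricted-Gaussian `L²` sizes of the EVEN and ODD parts of the tilt exponent and of `tiltU` itself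
# (ASSEMBLY-S5 §6 (e4)/(e5): the `E_0[Ũ_e²]`, `E_0[U_o²]`, `R((U−b)²)` slots of ✓`Tilt.abs_tiltCum3_muD_zero_le` / ✓`Tilt.abs_tiltCum4_muD_le`; LINE-19 S5 ⟨24004⟩)

With `D = smallField H s`, `U = tiltU β H`, `X := U + cubicVertex − b` (✓13K-U: `E₀[1_D X²] ≤ R := C(1+log H)^m(H⁸/β² + H¹²s⁶ + H⁸s⁸)`), the EXACT parity parts
`U_e(a) := (U(a) + U(−a))/2`, `U_o(a) := (U(a) − U(−a))/2` satisfy (cubicVertex is odd, ✓`cubicVertex_neg`)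
`U_e − b = (X(a) + X(−a))/2`, `U_o = (X(a) − X(−a))/2 − cubicVertex`, and the restricted Gaussian is reflection-symmetric
(`gaussAvg_sfInd_mul_comp_neg`, from LEAD's ✓`integral_comp_neg_edgeField`).  Hence (free-hands seat ym-line-fcl-p3 g26):

* ★`gaussAvg_sfInd_mul_sq_tiltU_even_sub_le` — `∃ b, E₀[1_D·(U_e − b)²] ≤ C(1+log H)^m(H⁸/β² + H¹²s⁶ + H⁸s⁸)` (same `R`);
* ★`gaussAvg_sfInd_mul_sq_tiltU_odd_le` — `E₀[1_D·U_o²] ≤ C(1+log H)^m(H⁴/β + H¹²s⁶ + H⁸s⁸)` (`2R + 2E₀[V₃²]`, ✓12a `cubicVariance`);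
* ★`gaussAvg_sfInd_mul_sq_tiltU_sub_le` — `∃ b, E₀[1_D·(U − b)²] ≤ C(1+log H)^m(H⁴/β + H¹²s⁶ + H⁸s⁸)` (the `R((U−b)²)` numerator of κ₄);
* plumbing: `gaussAvg_comp_neg`, `gaussAvg_sfInd_mul_comp_neg`, `gaussAvg_sfInd_mul_sq_cubicVertex_le` (`E₀[1_D V₃²] ≤ E₀[V₃²]`), boundedness ⇒ integrability
  via LEAD's ✓`Tilt.integrable_sfInd_mul` with w4's ✓`TiltSup.abs_tiltU_le_of ghostTaylor` / ✓`TiltSup.abs_cubicVertex_le` and ✓13u `measurable_tiltU`.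
Hypotheses throughout: `1 ≤ H`, `H⁴ ≤ β`, `0 ≤ s ≤ 1`, `s·H² ≤ c₀`.  (`E_0` over `μ_D` = these numerators divided by `E₀[1_D] ≥ 1/2`, ✓6g/✓13n.)

Mathlib + tree; no definitions.  HONEST LABEL: support sizes for the OPEN assembly T-S5.13 of the XL stub S5 of a critic-PASSed DRAFT line; S5, U5, ⟨24004⟩ ⟨24335⟩ ⟨24336⟩
remain OPEN; route AllWindowsColdBox is DRAFT; no rung is proved; **the Yang–Mills mass gap is NOT proved by this file; no summit is proved by a line.**
Seat ym-line-fcl-p3 g26 (cell ym-idea-1).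
-/

set_option autoImplicit false

noncomputable section

open MeasureTheory Matrix Finset
open Literature.MathematicalPhysics.QuantumLattice (plaquettesTouching)
open Literature.MathematicalPhysics.QuantumFieldTheory.AxialGauge (boxEdges)

namespace Summit.QuantumFields.YangMills.Theorems.AllWindowsColdBoxBoxHighLine

namespace GaussNormalForm

open EdgeChartGaussian (integrable_gaussWeight gaussAvg_mono_of_nonneg gaussAvg_const_fun integral_comp_neg_edgeField gaussWeight_neg sfInd_neg
  cubicVertex_neg neg_mem_smallField_iff)

variable {H : ℕ} {β : ℝ}

/-! ## §1 Reflection symmetry of (restricted) Gaussian averages -/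

/-- `E₀[F(−·)] = E₀[F]`. -/
theorem gaussAvg_comp_neg (β : ℝ) (H : ℕ) (F : (LandauFree H → E3) → ℝ) : gaussAvg β H (fun a => F (-a)) = gaussAvg β H F := by
  unfold gaussAvg
  congr 1
  have h := integral_comp_neg_edgeField (fun a => F a * gaussWeight β H a)
  simp only [gaussWeight_neg] at h
  exact h

/-- `E₀[1_D·F(−·)] = E₀[1_D·F]` (the small-field box is symmetric). -/
theorem gaussAvg_sfInd_mul_comp_neg (β : ℝ) (H : ℕ) (s : ℝ) (F : (LandauFree H → E3) → ℝ) :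
    gaussAvg β H (fun a => sfInd H s a * F (-a)) = gaussAvg β H (fun a => sfInd H s a * F a) := by
  have h := gaussAvg_comp_neg β H (fun a => sfInd H s a * F a)
  simp only [sfInd_neg] at h
  exact h

/-! ## §2 The cubic vertex restricted to `D` (✓12a) -/

/-- `V₃` is globally bounded: `|cubicVertex β H a| ≤ |β|·(4·#PT)`. -/
theorem abs_cubicVertex_le_const (β : ℝ) (H : ℕ) (a : LandauFree H → E3) :
    |cubicVertex β H a| ≤ |β| * (4 * (plaquettesTouching (boxEdges 4 (2 * H + 1))).card) := by
  rw [cubicVertex, abs_mul]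
  refine mul_le_mul_of_nonneg_left ?_ (abs_nonneg _)
  refine (Finset.abs_sum_le_sum_abs _ _).trans ?_
  calc ∑ p ∈ plaquettesTouching (boxEdges 4 (2 * H + 1)), |chartPlaqCostOdd H p.1 p.2.1.1 p.2.1.2 a|
      ≤ ∑ _p ∈ plaquettesTouching (boxEdges 4 (2 * H + 1)), (4 : ℝ) := Finset.sum_le_sum fun p _ => PlaqObsL2.abs_chartPlaqCostOdd_le_four H _ _ _ a
    _ = 4 * (plaquettesTouching (boxEdges 4 (2 * H + 1))).card := by rw [Finset.sum_const, nsmul_eq_mul]; ring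

/-- `V₃²·gaussWeight` is integrable. -/
theorem integrable_cubicVertex_sq_mul_gaussWeight (hβ : 0 < β) :
    Integrable (fun a : LandauFree H → E3 => cubicVertex β H a ^ 2 * gaussWeight β H a) := by
  set B : ℝ := |β| * (4 * (plaquettesTouching (boxEdges 4 (2 * H + 1))).card)
  refine ((integrable_gaussWeight H hβ).const_mul (B ^ 2)).mono'
    ((((measurable_cubicVertex β H).pow_const 2).mul (measurable_gaussWeight β H)).aestronglyMeasurable) ?_
  refine Filter.Eventually.of_forall fun a => ?_
  have hw := (EdgeChartGaussian.gaussWeight_pos β H a).le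
  rw [Real.norm_eq_abs, abs_of_nonneg (mul_nonneg (sq_nonneg _) hw)]
  refine mul_le_mul_of_nonneg_right ?_ hw
  rw [← sq_abs]
  exact pow_le_pow_left₀ (abs_nonneg _) (abs_cubicVertex_le_const β H a) 2

/-- `E₀[1_D · V₃²] ≤ C·H⁴(1+log H)^m/β` for `β ≥ H⁴`, `H ≥ 1` (✓`cubicVariance`, `0 ≤ 1_D ≤ 1`). -/
theorem gaussAvg_sfInd_mul_sq_cubicVertex_le : ∃ C : ℝ, ∃ m : ℕ, 0 ≤ C ∧ ∀ H : ℕ, 1 ≤ H → ∀ β : ℝ, (H : ℝ) ^ 4 ≤ β → ∀ s : ℝ,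
    gaussAvg β H (fun a => sfInd H s a * cubicVertex β H a ^ 2) ≤ C * (H : ℝ) ^ 4 * (1 + Real.log H) ^ m / β := by
  obtain ⟨C, m, hC⟩ := cubicVariance
  refine ⟨max C 0, m, le_max_right _ _, fun H hH β hβ s => ?_⟩
  have hH' : (1 : ℝ) ≤ H := by exact_mod_cast hH
  have hβpos : 0 < β := lt_of_lt_of_le (by positivity) hβ
  have hlog : 0 ≤ Real.log H := Real.log_nonneg hH'
  have h1 : ∀ a, sfInd H s a * cubicVertex β H a ^ 2 ≤ cubicVertex β H a ^ 2 := by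
    intro a
    have h0 : 0 ≤ sfInd H s a := by unfold sfInd; exact Set.indicator_nonneg (fun _ _ => zero_le_one) _
    have h1 : sfInd H s a ≤ 1 := by
      unfold sfInd; exact Set.indicator_le_self' (fun _ _ => zero_le_one) _
    nlinarith [sq_nonneg (cubicVertex β H a)]
  have h0 : ∀ a, 0 ≤ sfInd H s a * cubicVertex β H a ^ 2 := fun a =>
    mul_nonneg (by unfold sfInd; exact Set.indicator_nonneg (fun _ _ => zero_le_one) _) (sq_nonneg _)
  calc gaussAvg β H (fun a => sfInd H s a * cubicVertex β H a ^ 2) ≤ gaussAvg β H (fun a => cubicVertex β H a ^ 2) :=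
        gaussAvg_mono_of_nonneg H hβpos h0 h1 (integrable_cubicVertex_sq_mul_gaussWeight hβpos)
    _ ≤ C * (H : ℝ) ^ 4 * (1 + Real.log H) ^ m / β := hC H hH β hβ
    _ ≤ max C 0 * (H : ℝ) ^ 4 * (1 + Real.log H) ^ m / β := by
        refine div_le_div_of_nonneg_right ?_ hβpos.le
        exact mul_le_mul_of_nonneg_right (mul_le_mul_of_nonneg_right (le_max_left _ _) (by positivity)) (by positivity)

/-! ## §3 Three pointwise algebraic facts (stated in a clean context) -/

/-- `σ·((p+q)/2)² ≤ ½σp² + ½σq²` for `σ ≥ 0`. -/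
theorem aux_even (p q : ℝ) {σ : ℝ} (hσ : 0 ≤ σ) : σ * ((p + q) / 2) ^ 2 ≤ 1 / 2 * (σ * p ^ 2) + 1 / 2 * (σ * q ^ 2) := by
  have h : ((p + q) / 2) ^ 2 ≤ (p ^ 2 + q ^ 2) / 2 := by nlinarith [sq_nonneg (p - q)]
  nlinarith

/-- `σ·((p−q)/2 − v)² ≤ (σp² + σq²) + 2σv²` for `σ ≥ 0`. -/
theorem aux_odd (p q v : ℝ) {σ : ℝ} (hσ : 0 ≤ σ) : σ * ((p - q) / 2 - v) ^ 2 ≤ (σ * p ^ 2 + σ * q ^ 2) + 2 * (σ * v ^ 2) := by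
  have h : ((p - q) / 2 - v) ^ 2 ≤ p ^ 2 + q ^ 2 + 2 * v ^ 2 := by
    nlinarith [sq_nonneg (p + q), sq_nonneg ((p - q) / 2 + v)]
  nlinarith

/-- `σ·(p − v)² ≤ 2σp² + 2σv²` for `σ ≥ 0`. -/
theorem aux_full (p v : ℝ) {σ : ℝ} (hσ : 0 ≤ σ) : σ * (p - v) ^ 2 ≤ 2 * (σ * p ^ 2) + 2 * (σ * v ^ 2) := by
  have h : (p - v) ^ 2 ≤ 2 * p ^ 2 + 2 * v ^ 2 := by nlinarith [sq_nonneg (p + v)]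
  nlinarith

/-! ## §4 The parity sizes -/

/-- ★ **Parity sizes of the tilt exponent on `D`.**  There are `C, c₀ > 0, m` such that for `H ≥ 1`, `β ≥ H⁴`, `0 ≤ s ≤ 1`, `s·H² ≤ c₀` there is `b` with
(even) `E₀[1_D·((U(a)+U(−a))/2 − b)²] ≤ C(1+log H)^m(H⁸/β² + H¹²s⁶ + H⁸s⁸)`, (odd) `E₀[1_D·((U(a)−U(−a))/2)²] ≤ C(1+log H)^m(H⁴/β + H¹²s⁶ + H⁸s⁸)` and
(full) `E₀[1_D·(U − b)²] ≤ C(1+log H)^m(H⁴/β + H¹²s⁶ + H⁸s⁸)`, `U = tiltU β H`. -/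
theorem gaussAvg_sfInd_mul_sq_tiltU_parity_le :
    ∃ C c₀ : ℝ, ∃ m : ℕ, 0 < c₀ ∧ ∀ H : ℕ, 1 ≤ H → ∀ β : ℝ, (H : ℝ) ^ 4 ≤ β → ∀ s : ℝ, 0 ≤ s → s ≤ 1 → s * (H : ℝ) ^ 2 ≤ c₀ →
      ∃ b : ℝ,
        gaussAvg β H (fun a => sfInd H s a * ((tiltU β H a + tiltU β H (-a)) / 2 - b) ^ 2) ≤
            C * (1 + Real.log H) ^ m * ((H : ℝ) ^ 8 / β ^ 2 + (H : ℝ) ^ 12 * s ^ 6 + (H : ℝ) ^ 8 * s ^ 8) ∧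
        gaussAvg β H (fun a => sfInd H s a * ((tiltU β H a - tiltU β H (-a)) / 2) ^ 2) ≤
            C * (1 + Real.log H) ^ m * ((H : ℝ) ^ 4 / β + (H : ℝ) ^ 12 * s ^ 6 + (H : ℝ) ^ 8 * s ^ 8) ∧
        gaussAvg β H (fun a => sfInd H s a * (tiltU β H a - b) ^ 2) ≤
            C * (1 + Real.log H) ^ m * ((H : ℝ) ^ 4 / β + (H : ℝ) ^ 12 * s ^ 6 + (H : ℝ) ^ 8 * s ^ 8) := by
  obtain ⟨CR, cR, mR, hcR, hR⟩ := gaussAvg_sfInd_mul_sq_tiltU_add_cubicVertex_sub_le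
  obtain ⟨CV, mV, hCV0, hV⟩ := gaussAvg_sfInd_mul_sq_cubicVertex_le
  obtain ⟨CT, cT, mT, hcT, hT⟩ := TiltSup.abs_tiltU_le_of ghostTaylor
  have hc1 : |CR| ≤ 2 * |CR| + 2 * CV := by have := abs_nonneg CR; linarith
  refine ⟨2 * |CR| + 2 * CV, min cR cT, mR + mV, lt_min hcR hcT, fun H hH β hβ s hs0 hs1 hsH => ?_⟩
  have hH' : (1 : ℝ) ≤ H := by exact_mod_cast hH
  have hβpos : 0 < β := lt_of_lt_of_le (by positivity) hβ
  have hlog : 0 ≤ Real.log H := Real.log_nonneg hH'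
  have hsR : s * (H : ℝ) ^ 2 ≤ cR := hsH.trans (min_le_left _ _)
  have hsT : s * (H : ℝ) ^ 2 ≤ cT := hsH.trans (min_le_right _ _)
  obtain ⟨b, hb⟩ := hR H hH β hβ s hs0 hs1 hsR
  have hVs := hV H hH β hβ s
  refine ⟨b, ?_⟩
  -- sizes and their comparison
  set L : ℝ := 1 + Real.log H with hL
  have hL1 : 1 ≤ L := by simp only [hL]; linarith
  set X8 : ℝ := (H : ℝ) ^ 8 / β ^ 2 + (H : ℝ) ^ 12 * s ^ 6 + (H : ℝ) ^ 8 * s ^ 8 with hX8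
  set X4 : ℝ := (H : ℝ) ^ 4 / β + (H : ℝ) ^ 12 * s ^ 6 + (H : ℝ) ^ 8 * s ^ 8 with hX4
  have hX80 : 0 ≤ X8 := by positivity
  have hX40 : 0 ≤ X4 := by positivity
  have h84 : (H : ℝ) ^ 8 / β ^ 2 ≤ (H : ℝ) ^ 4 / β := by
    have hq : (H : ℝ) ^ 4 / β ≤ 1 := (div_le_one hβpos).2 hβ
    have hq0 : 0 ≤ (H : ℝ) ^ 4 / β := by positivity
    calc (H : ℝ) ^ 8 / β ^ 2 = (H : ℝ) ^ 4 / β * ((H : ℝ) ^ 4 / β) := by ring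
      _ ≤ (H : ℝ) ^ 4 / β * 1 := mul_le_mul_of_nonneg_left hq hq0
      _ = (H : ℝ) ^ 4 / β := mul_one _
  have hX84 : X8 ≤ X4 := by simp only [hX8, hX4]; linarith
  have hX4V : (H : ℝ) ^ 4 / β ≤ X4 := by
    have : 0 ≤ (H : ℝ) ^ 12 * s ^ 6 + (H : ℝ) ^ 8 * s ^ 8 := by positivity
    simp only [hX4]; linarith
  have hLR : L ^ mR ≤ L ^ (mR + mV) := pow_le_pow_right₀ hL1 (Nat.le_add_right _ _)
  have hLV : L ^ mV ≤ L ^ (mR + mV) := pow_le_pow_right₀ hL1 (Nat.le_add_left _ _)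
  -- R and V in the common currency
  have hRle : CR * L ^ mR * X8 ≤ |CR| * L ^ (mR + mV) * X8 :=
    mul_le_mul_of_nonneg_right (mul_le_mul (le_abs_self _) hLR (by positivity) (abs_nonneg _)) hX80
  have hRle4 : |CR| * L ^ (mR + mV) * X8 ≤ |CR| * L ^ (mR + mV) * X4 := mul_le_mul_of_nonneg_left hX84 (by positivity)
  have hVle : CV * (H : ℝ) ^ 4 * L ^ mV / β ≤ CV * L ^ (mR + mV) * X4 := by
    calc CV * (H : ℝ) ^ 4 * L ^ mV / β = CV * L ^ mV * ((H : ℝ) ^ 4 / β) := by ring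
      _ ≤ CV * L ^ (mR + mV) * X4 := mul_le_mul (mul_le_mul_of_nonneg_left hLV hCV0) hX4V (by positivity) (by positivity)
  -- the function `X = U + V₃ − b` (kept OPAQUE: unfolding `tiltU` under `isDefEq` is prohibitively expensive) and its reflection
  obtain ⟨X, hX⟩ : ∃ X : (LandauFree H → E3) → ℝ, ∀ a, X a = tiltU β H a + cubicVertex β H a - b := ⟨_, fun _ => rfl⟩
  have hXfun : (fun a => tiltU β H a + cubicVertex β H a - b) = X := funext fun a => (hX a).symm
  have hbX : gaussAvg β H (fun a => sfInd H s a * X a ^ 2) ≤ CR * L ^ mR * X8 := by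
    have h := hb
    simp only [← hX] at h
    exact h
  have hbX' : gaussAvg β H (fun a => sfInd H s a * X (-a) ^ 2) ≤ CR * L ^ mR * X8 := by
    rw [gaussAvg_sfInd_mul_comp_neg β H s (fun a => X a ^ 2)]; exact hbX
  -- boundedness on D ⇒ integrability of the three majorant pieces
  set BU : ℝ := CT * (1 + Real.log H) ^ mT * (|β| * (H : ℝ) ^ 4 * s ^ 3 + (H : ℝ) ^ 6 * s ^ 2) with hBU
  set BV : ℝ := 409600 * |β| * (H : ℝ) ^ 4 * s ^ 3 with hBV
  have hXb : ∀ a ∈ smallField H s, |X a| ≤ BU + BV + |b| := by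
    intro a ha
    have h1 := hT H hH β s hs0 hs1 hsT a ha
    have h2 := TiltSup.abs_cubicVertex_le hH β hs0 hs1 ha
    calc |X a| = |tiltU β H a + cubicVertex β H a + (-b)| := by rw [hX a, sub_eq_add_neg]
      _ ≤ |tiltU β H a + cubicVertex β H a| + |-b| := abs_add_le _ _
      _ ≤ |tiltU β H a| + |cubicVertex β H a| + |-b| := add_le_add (abs_add_le _ _) le_rfl
      _ ≤ BU + BV + |b| := by rw [abs_neg]; exact add_le_add (add_le_add h1 h2) le_rfl
  have hB0 : 0 ≤ (BU + BV + |b|) ^ 2 := sq_nonneg _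
  have hXm : Measurable X := by rw [← hXfun]; exact ((measurable_tiltU β H).add (measurable_cubicVertex β H)).sub_const b
  have hXsq : ∀ a ∈ smallField H s, |X a ^ 2| ≤ (BU + BV + |b|) ^ 2 := fun a ha => by
    rw [abs_pow]; exact pow_le_pow_left₀ (abs_nonneg _) (hXb a ha) 2
  have hXsq' : ∀ a ∈ smallField H s, |X (-a) ^ 2| ≤ (BU + BV + |b|) ^ 2 := fun a ha =>
    hXsq (-a) ((neg_mem_smallField_iff s a).2 ha)
  have hiX : Integrable (fun a => sfInd H s a * X a ^ 2 * gaussWeight β H a) :=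
    Tilt.integrable_sfInd_mul H hβpos s (hXm.pow_const 2) hB0 hXsq
  have hiX' : Integrable (fun a => sfInd H s a * X (-a) ^ 2 * gaussWeight β H a) :=
    Tilt.integrable_sfInd_mul H hβpos s ((hXm.comp measurable_neg).pow_const 2) hB0 hXsq'
  have hiV : Integrable (fun a => sfInd H s a * cubicVertex β H a ^ 2 * gaussWeight β H a) :=
    Tilt.integrable_sfInd_mul H hβpos s ((measurable_cubicVertex β H).pow_const 2) (sq_nonneg BV) fun a ha => by
      rw [abs_pow]; exact pow_le_pow_left₀ (abs_nonneg _) (TiltSup.abs_cubicVertex_le hH β hs0 hs1 ha) 2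
  have hsf0 : ∀ a, 0 ≤ sfInd H s a := fun a => by unfold sfInd; exact Set.indicator_nonneg (fun _ _ => zero_le_one) _
  -- the algebra of the parity parts
  have heven : ∀ a, (tiltU β H a + tiltU β H (-a)) / 2 - b = (X a + X (-a)) / 2 := by
    intro a; rw [hX a, hX (-a), cubicVertex_neg]; ring
  have hodd : ∀ a, (tiltU β H a - tiltU β H (-a)) / 2 = (X a - X (-a)) / 2 - cubicVertex β H a := by
    intro a; rw [hX a, hX (-a), cubicVertex_neg]; ring
  have hfull : ∀ a, tiltU β H a - b = X a - cubicVertex β H a := by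
    intro a; rw [hX a]; ring
  refine ⟨?_, ?_, ?_⟩
  · -- even part: ((X a + X(−a))/2)² ≤ (X a² + X(−a)²)/2
    have hdom : ∀ a, sfInd H s a * ((tiltU β H a + tiltU β H (-a)) / 2 - b) ^ 2 ≤
        (1 / 2) * (sfInd H s a * X a ^ 2) + (1 / 2) * (sfInd H s a * X (-a) ^ 2) := by
      intro a
      rw [heven]
      exact aux_even (X a) (X (-a)) (hsf0 a)
    have hi : Integrable (fun a => ((1 / 2) * (sfInd H s a * X a ^ 2) + (1 / 2) * (sfInd H s a * X (-a) ^ 2)) * gaussWeight β H a) :=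
      ((hiX.const_mul (1 / 2)).add (hiX'.const_mul (1 / 2))).congr (Filter.Eventually.of_forall fun a => by simp only [Pi.add_apply]; ring)
    calc gaussAvg β H (fun a => sfInd H s a * ((tiltU β H a + tiltU β H (-a)) / 2 - b) ^ 2)
        ≤ gaussAvg β H (fun a => (1 / 2) * (sfInd H s a * X a ^ 2) + (1 / 2) * (sfInd H s a * X (-a) ^ 2)) :=
          gaussAvg_mono_of_nonneg H hβpos (fun a => mul_nonneg (hsf0 a) (sq_nonneg _)) hdom hi
      _ = (1 / 2) * gaussAvg β H (fun a => sfInd H s a * X a ^ 2) + (1 / 2) * gaussAvg β H (fun a => sfInd H s a * X (-a) ^ 2) := by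
          have hi1 : Integrable (fun a => (1 / 2) * (sfInd H s a * X a ^ 2) * gaussWeight β H a) :=
            (hiX.const_mul (1 / 2)).congr (Filter.Eventually.of_forall fun a => by ring)
          have hi2 : Integrable (fun a => (1 / 2) * (sfInd H s a * X (-a) ^ 2) * gaussWeight β H a) :=
            (hiX'.const_mul (1 / 2)).congr (Filter.Eventually.of_forall fun a => by ring)
          rw [EdgeChartGaussian.gaussAvg_add β H hi1 hi2, EdgeChartGaussian.gaussAvg_const_mul, EdgeChartGaussian.gaussAvg_const_mul]
      _ ≤ (1 / 2) * (CR * L ^ mR * X8) + (1 / 2) * (CR * L ^ mR * X8) := by linarith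
      _ = CR * L ^ mR * X8 := by ring
      _ ≤ |CR| * L ^ (mR + mV) * X8 := hRle
      _ ≤ (2 * |CR| + 2 * CV) * L ^ (mR + mV) * X8 :=
          mul_le_mul_of_nonneg_right (mul_le_mul_of_nonneg_right hc1 (by positivity)) hX80
  · -- odd part: ((X a − X(−a))/2 − V₃)² ≤ X a² + X(−a)² + 2V₃²
    have hdom : ∀ a, sfInd H s a * ((tiltU β H a - tiltU β H (-a)) / 2) ^ 2 ≤
        (sfInd H s a * X a ^ 2 + sfInd H s a * X (-a) ^ 2) + 2 * (sfInd H s a * cubicVertex β H a ^ 2) := by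
      intro a
      rw [hodd]
      exact aux_odd (X a) (X (-a)) (cubicVertex β H a) (hsf0 a)
    have hi12 : Integrable (fun a => (sfInd H s a * X a ^ 2 + sfInd H s a * X (-a) ^ 2) * gaussWeight β H a) :=
      (hiX.add hiX').congr (Filter.Eventually.of_forall fun a => by simp only [Pi.add_apply]; ring)
    have hiV2 : Integrable (fun a => 2 * (sfInd H s a * cubicVertex β H a ^ 2) * gaussWeight β H a) :=
      (hiV.const_mul 2).congr (Filter.Eventually.of_forall fun a => by ring)
    have hi : Integrable (fun a => ((sfInd H s a * X a ^ 2 + sfInd H s a * X (-a) ^ 2) + 2 * (sfInd H s a * cubicVertex β H a ^ 2)) * gaussWeight β H a) :=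
      (hi12.add hiV2).congr (Filter.Eventually.of_forall fun a => by simp only [Pi.add_apply]; ring)
    calc gaussAvg β H (fun a => sfInd H s a * ((tiltU β H a - tiltU β H (-a)) / 2) ^ 2)
        ≤ gaussAvg β H (fun a => (sfInd H s a * X a ^ 2 + sfInd H s a * X (-a) ^ 2) + 2 * (sfInd H s a * cubicVertex β H a ^ 2)) :=
          gaussAvg_mono_of_nonneg H hβpos (fun a => mul_nonneg (hsf0 a) (sq_nonneg _)) hdom hi
      _ = gaussAvg β H (fun a => sfInd H s a * X a ^ 2) + gaussAvg β H (fun a => sfInd H s a * X (-a) ^ 2) +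
            2 * gaussAvg β H (fun a => sfInd H s a * cubicVertex β H a ^ 2) := by
          rw [EdgeChartGaussian.gaussAvg_add β H hi12 hiV2, EdgeChartGaussian.gaussAvg_add β H hiX hiX', EdgeChartGaussian.gaussAvg_const_mul]
      _ ≤ CR * L ^ mR * X8 + CR * L ^ mR * X8 + 2 * (CV * (H : ℝ) ^ 4 * L ^ mV / β) := by linarith
      _ ≤ |CR| * L ^ (mR + mV) * X4 + |CR| * L ^ (mR + mV) * X4 + 2 * (CV * L ^ (mR + mV) * X4) := by linarith
      _ = (2 * |CR| + 2 * CV) * L ^ (mR + mV) * X4 := by ring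
  · -- full: (X − V₃)² ≤ 2X² + 2V₃²
    have hdom : ∀ a, sfInd H s a * (tiltU β H a - b) ^ 2 ≤ 2 * (sfInd H s a * X a ^ 2) + 2 * (sfInd H s a * cubicVertex β H a ^ 2) := by
      intro a
      rw [hfull]
      exact aux_full (X a) (cubicVertex β H a) (hsf0 a)
    have hi1 : Integrable (fun a => 2 * (sfInd H s a * X a ^ 2) * gaussWeight β H a) := (hiX.const_mul 2).congr (Filter.Eventually.of_forall fun a => by ring)
    have hi2 : Integrable (fun a => 2 * (sfInd H s a * cubicVertex β H a ^ 2) * gaussWeight β H a) :=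
      (hiV.const_mul 2).congr (Filter.Eventually.of_forall fun a => by ring)
    have hi : Integrable (fun a => (2 * (sfInd H s a * X a ^ 2) + 2 * (sfInd H s a * cubicVertex β H a ^ 2)) * gaussWeight β H a) :=
      (hi1.add hi2).congr (Filter.Eventually.of_forall fun a => by simp only [Pi.add_apply]; ring)
    calc gaussAvg β H (fun a => sfInd H s a * (tiltU β H a - b) ^ 2)
        ≤ gaussAvg β H (fun a => 2 * (sfInd H s a * X a ^ 2) + 2 * (sfInd H s a * cubicVertex β H a ^ 2)) :=
          gaussAvg_mono_of_nonneg H hβpos (fun a => mul_nonneg (hsf0 a) (sq_nonneg _)) hdom hi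
      _ = 2 * gaussAvg β H (fun a => sfInd H s a * X a ^ 2) + 2 * gaussAvg β H (fun a => sfInd H s a * cubicVertex β H a ^ 2) := by
          rw [EdgeChartGaussian.gaussAvg_add β H hi1 hi2, EdgeChartGaussian.gaussAvg_const_mul, EdgeChartGaussian.gaussAvg_const_mul]
      _ ≤ 2 * (CR * L ^ mR * X8) + 2 * (CV * (H : ℝ) ^ 4 * L ^ mV / β) := by linarith
      _ ≤ 2 * (|CR| * L ^ (mR + mV) * X4) + 2 * (CV * L ^ (mR + mV) * X4) := by linarith
      _ = (2 * |CR| + 2 * CV) * L ^ (mR + mV) * X4 := by ring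

/-- ★ **Even part, stand-alone**: `∃ b, E₀[1_D·((U(a)+U(−a))/2 − b)²] ≤ C(1+log H)^m(H⁸/β² + H¹²s⁶ + H⁸s⁸)`. -/
theorem gaussAvg_sfInd_mul_sq_tiltU_even_sub_le :
    ∃ C c₀ : ℝ, ∃ m : ℕ, 0 < c₀ ∧ ∀ H : ℕ, 1 ≤ H → ∀ β : ℝ, (H : ℝ) ^ 4 ≤ β → ∀ s : ℝ, 0 ≤ s → s ≤ 1 → s * (H : ℝ) ^ 2 ≤ c₀ →
      ∃ b : ℝ, gaussAvg β H (fun a => sfInd H s a * ((tiltU β H a + tiltU β H (-a)) / 2 - b) ^ 2) ≤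
        C * (1 + Real.log H) ^ m * ((H : ℝ) ^ 8 / β ^ 2 + (H : ℝ) ^ 12 * s ^ 6 + (H : ℝ) ^ 8 * s ^ 8) := by
  obtain ⟨C, c₀, m, hc₀, h⟩ := gaussAvg_sfInd_mul_sq_tiltU_parity_le
  exact ⟨C, c₀, m, hc₀, fun H hH β hβ s hs0 hs1 hsH => by
    obtain ⟨b, hb, -, -⟩ := h H hH β hβ s hs0 hs1 hsH; exact ⟨b, hb⟩⟩

/-- ★ **Odd part, stand-alone**: `E₀[1_D·((U(a)−U(−a))/2)²] ≤ C(1+log H)^m(H⁴/β + H¹²s⁶ + H⁸s⁸)`. -/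
theorem gaussAvg_sfInd_mul_sq_tiltU_odd_le :
    ∃ C c₀ : ℝ, ∃ m : ℕ, 0 < c₀ ∧ ∀ H : ℕ, 1 ≤ H → ∀ β : ℝ, (H : ℝ) ^ 4 ≤ β → ∀ s : ℝ, 0 ≤ s → s ≤ 1 → s * (H : ℝ) ^ 2 ≤ c₀ →
      gaussAvg β H (fun a => sfInd H s a * ((tiltU β H a - tiltU β H (-a)) / 2) ^ 2) ≤
        C * (1 + Real.log H) ^ m * ((H : ℝ) ^ 4 / β + (H : ℝ) ^ 12 * s ^ 6 + (H : ℝ) ^ 8 * s ^ 8) := by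
  obtain ⟨C, c₀, m, hc₀, h⟩ := gaussAvg_sfInd_mul_sq_tiltU_parity_le
  exact ⟨C, c₀, m, hc₀, fun H hH β hβ s hs0 hs1 hsH => by
    obtain ⟨b, -, hb, -⟩ := h H hH β hβ s hs0 hs1 hsH; exact hb⟩

/-- ★ **The `R((U−b)²)` numerator of κ₄**: `∃ b, E₀[1_D·(tiltU − b)²] ≤ C(1+log H)^m(H⁴/β + H¹²s⁶ + H⁸s⁸)`. -/
theorem gaussAvg_sfInd_mul_sq_tiltU_sub_le :
    ∃ C c₀ : ℝ, ∃ m : ℕ, 0 < c₀ ∧ ∀ H : ℕ, 1 ≤ H → ∀ β : ℝ, (H : ℝ) ^ 4 ≤ β → ∀ s : ℝ, 0 ≤ s → s ≤ 1 → s * (H : ℝ) ^ 2 ≤ c₀ →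
      ∃ b : ℝ, gaussAvg β H (fun a => sfInd H s a * (tiltU β H a - b) ^ 2) ≤
        C * (1 + Real.log H) ^ m * ((H : ℝ) ^ 4 / β + (H : ℝ) ^ 12 * s ^ 6 + (H : ℝ) ^ 8 * s ^ 8) := by
  obtain ⟨C, c₀, m, hc₀, h⟩ := gaussAvg_sfInd_mul_sq_tiltU_parity_le
  exact ⟨C, c₀, m, hc₀, fun H hH β hβ s hs0 hs1 hsH => by
    obtain ⟨b, -, -, hb⟩ := h H hH β hβ s hs0 hs1 hsH; exact ⟨b, hb⟩⟩

end GaussNormalForm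

end Summit.QuantumFields.YangMills.Theorems.AllWindowsColdBoxBoxHighLine

end
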